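import Literature.AlgebraicGeometry.HodgeTheory.ExpTwistClassesExponentialLaw
import Literature.AlgebraicGeometry.HodgeTheory.HardLefschetzNFold
import HarnessLib

/-!
# The composition law of `B`-twists: `exp(B + B') ∪ κ = exp(B') ∪ (exp(B) ∪ κ)` in every degree

Family `hodge`, layer `Literature/AlgebraicGeometry/HodgeTheory`. THEOREMS ONLY (no definition, no named fact) about the tree's
`B`-twist of a family of even-degree classes `expTwistClasses X B κ k = Σ_{i ≤ k} (1/i!) Bⁱ ∪ κ_{k−i}`
(`SemiregularVariationalHodgeTwistedPerfect.lean` §2; the operation `ch ↦ ch^B = ch · exp(B)` of Huybrechts–Stellari, the class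
`w₀ = exp(B₀) · ch(E₀)` of Perry's Thm. 1.1, Markman's `κ(F) = ch(F) · exp(−c₁(F)/r)`).

* §1 Bookkeeping (the degree equation `2 + 2j = 2(j+1)` is the tree's `two_add_two_mul`, `HardLefschetzNFold.lean`): `expTwistClasses X B κ k` depends only on `κ_j`, `j ≤ k` (`expTwistClasses_congr`); degree `0` is untouched
  (`expTwistClasses_deg_zero`); transport of a family index inside a cup product; even-degree classes commute past a degree-`2` class.
* §2 The degree-raising operator `κ ↦ (0, B ∪ κ₀, B ∪ κ₁, …)` on families TRUNCATED above degree `N` — introduced only through its three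
  characteristic properties (`(Tκ)₀ = 0`, `(Tκ)_{j+1} = B ∪ κ_j` for `j + 1 ≤ N`, `(Tκ)_j = 0` for `j > N`; existence
  `exists_twistShift`, no definition is added to the tree): its powers are `(Tⁱκ)_k = Bⁱ ∪ κ_{k−i}` (`twistShift_pow_apply`), it is
  nilpotent (`T^{N+1} = 0`), additive in `B`, two such operators commute (graded commutativity in even degrees), and its truncated
  exponential `Σ_{i ≤ N} (1/i!) Tⁱ` computes `expTwistClasses` in every degree `k ≤ N` (`twistShift_expSum_apply`).
* §3 CONSUMER FORMS OF THE COMPOSITION LAW. THE LAW ITSELF — `(exp(B + B') ∪ κ)_k = (exp(B) ∪ (exp(B') ∪ κ))_k` — IS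
  `Literature.AlgebraicGeometry.HodgeTheory.expTwistClasses_add` of `ExpTwistClassesExponentialLaw.lean` (ring2-b06 gen 123, p555680, proved by the
  same operator device kept inside its proof; also `expTwistClasses_comm`, `…_neg_expTwistClasses`, `…_expTwistClasses_neg`, `…_add_family`,
  `…_smul_family`, `…_apply_zero/one`, `exists_expTwistClasses_smul_onRay`). VERSION NOTE: v1 of THIS module (p555993, 2026-08-27T18:29Z) carried a
  second proof of the law under the SAME three names `expTwistClasses_add` (arguments in the other order), `expTwistClasses_neg_expTwistClasses`,
  `expTwistClasses_expTwistClasses_neg`, landed within the same minute as p555680 (a dedup race); two modules declaring one fully-qualified name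
  cannot be imported together (`import … failed, environment already contains …`), so v2 REMOVES those three declarations and the restatements
  `expTwistClasses_add'`, `expTwistClasses_deg_zero`, `cupProduct_cupPowTwo_cupPowTwo_eq`, `cupPowTwo_smul_eq_pow_smul` (= `expTwistClasses_add`,
  `expTwistClasses_apply_zero`, `cupProduct_cupPowTwo_cupPowTwo`, `Hyperkaehler.cupPowTwo_smul`), imports p555680, and keeps what is not there:
  §1–§2 (index transport, `expTwistClasses_congr`, the degree-raising operator as a reusable API with its power formula and truncated exponential)
  and the consumer forms `expTwistClasses_eq_of_eq_add` (re-gauging `B = B₁ + B₂`) and `expTwistCh_add` (module form), now ONE-LINE COROLLARIES of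
  p555680's law. Nothing referenced the removed names through this module.
* §4 RAY STABILITY in membership form: the twist by a multiple `μ·θ` of a class `θ` moves a family whose lower members lie on the ray `ℂ·θ^j`
  only by a multiple of `θ^k` in degree `k` (`expTwistClasses_smul_sub_mem_span_cupPowTwo`, from p555680's `…_of_onRay`), and the top
  coefficient of a served class is gauge-invariant (`exists_expTwistClasses_smul_eq_add`).

WHY (consumer): on the Buchweitz–Flenner disjunct of the primed twisted door of road `VHCAbelianSchemesRoad` the `B`-field of a positive-rank
sheaf datum can be RE-GAUGED to Markman's `−c₁/r` (`Summits/…/Theorems/VHCAbelianSchemesRoadTwistedCarrierPrimeGauge.lean`); the re-gauging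
is `exp(B₀) = exp(λθ) ∘ exp(B₀ − λθ)`, i.e. the law, and its effect on ray-valued side conditions is §4.
What is NOT here: the law itself (p555680); no statement about Chern characters of tensor products; no ring structure on `⊕_k H^{2k}`.
References: [cite: HuybrechtsStellari2005, §1 (twisted Chern character, `ch^{B+B'} = (ch^B)^{B'}`)] [cite: HatcherAT2002, §3.2 and Thm. 3.11]
[cite: Markman2025SecantWeil, §1.1 (κ-class)] [cite: Perry2026Semiregularity, Thm. 1.1].
-/

noncomputable section

namespace Literature.AlgebraicGeometry.HodgeTheory

open Literature.AlgebraicGeometry.Motives Literature.AlgebraicTopology.SingularHomology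

variable {X : SchemeOver ℂ}

/-! ### §1 Bookkeeping -/

/-- Transport of a FAMILY INDEX inside a cup product: `x ∪ κ_a = x ∪ κ_b` for `a = b` (the two sides live in the same degree through
possibly different degree equations of the graded product `H^p × H^{2a} → H^s`). [cite: HatcherAT2002, §3.2 (the cup product is graded)] -/
theorem cupProduct_family_congr {p s : ℕ} (x : complexBetti X p) (κ : (j : ℕ) → complexBetti X (2 * j)) {a b : ℕ} (hab : a = b)
    (h : p + 2 * a = s) (h' : p + 2 * b = s) : cupProduct h x (κ a) = cupProduct h' x (κ b) := by
  subst hab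
  rfl

/-- A degree-`2` class commutes with every even-degree class: `a ∪ b = b ∪ a` for `a ∈ H²`, `b ∈ H^{2q'}` written `H^q`, `q = 2q'`
(graded commutativity, sign `(−1)^{2q} = 1`). [cite: HatcherAT2002, Thm. 3.11] -/
theorem cupProduct_comm_of_deg_two {Y : Type} [TopologicalSpace Y] {q n : ℕ} (h : 2 + q = n) (h' : q + 2 = n)
    (a : singularCohomology ℂ ℂ Y 2) (b : singularCohomology ℂ ℂ Y q) : cupProduct h a b = cupProduct h' b a := by
  rw [cupProduct_gradedComm_holds ℂ Y h h' a b, pow_mul, neg_one_sq, one_pow, one_smul]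

/-- **`(exp(B) ∪ κ)_k` depends only on `κ₀, …, κ_k`.** [cite: HuybrechtsStellari2005, §1] -/
theorem expTwistClasses_congr (B : complexBetti X 2) {κ κ' : (j : ℕ) → complexBetti X (2 * j)} (k : ℕ)
    (h : ∀ j ≤ k, κ j = κ' j) : expTwistClasses X B κ k = expTwistClasses X B κ' k := by
  unfold expTwistClasses
  refine Finset.sum_congr rfl fun i _ => ?_
  rw [h (k - i) (Nat.sub_le k i)]

/-! ### §2 The truncated degree-raising operator, through its characteristic properties -/

section Operator

variable {N : ℕ} {B B' : complexBetti X 2} {T T' : Module.End ℂ ((j : ℕ) → complexBetti X (2 * j))}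

/-- **Existence of the truncated degree-raising operator** `T = T_{N,B}` on families `κ = (κ_j)_j`, `κ_j ∈ H^{2j}(X(ℂ); ℂ)`:
`(Tκ)₀ = 0`, `(Tκ)_{j+1} = B ∪ κ_j` for `j + 1 ≤ N`, and `(Tκ)_j = 0` above the truncation degree `N` (a `ℂ`-linear endomorphism;
witness: the product of the linear maps `κ ↦ B ∪ κ_j`). [cite: HatcherAT2002, §3.2] -/
theorem exists_twistShift (N : ℕ) (B : complexBetti X 2) :
    ∃ T : Module.End ℂ ((j : ℕ) → complexBetti X (2 * j)),
      (∀ κ, T κ 0 = 0) ∧ (∀ κ j, j + 1 ≤ N → T κ (j + 1) = cupProduct (two_add_two_mul j) B (κ j)) ∧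
        ∀ κ j, N < j → T κ j = 0 := by
  classical
  let comp : (j : ℕ) → (((j : ℕ) → complexBetti X (2 * j)) →ₗ[ℂ] complexBetti X (2 * j)) := fun j =>
    match j with
    | 0 => 0
    | j + 1 => (cupProduct (two_add_two_mul j) B).comp (LinearMap.proj j)
  refine ⟨LinearMap.pi fun j => if j ≤ N then comp j else 0, fun κ => ?_, fun κ j hj => ?_, fun κ j hj => ?_⟩
  · simp only [LinearMap.pi_apply]
    split_ifs <;> rfl
  · simp only [LinearMap.pi_apply, if_pos hj]
    rfl
  · simp only [LinearMap.pi_apply, if_neg (not_le.2 hj), LinearMap.zero_apply]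

/-- **Powers raise the degree**: `(Tⁱκ)_k = 0` for `k < i`. [cite: HatcherAT2002, §3.2] -/
theorem twistShift_pow_apply_eq_zero_of_lt (h0 : ∀ κ, T κ 0 = 0)
    (hs : ∀ κ j, j + 1 ≤ N → T κ (j + 1) = cupProduct (two_add_two_mul j) B (κ j))
    (hgt : ∀ κ j, N < j → T κ j = 0) :
    ∀ (i : ℕ) (κ : (j : ℕ) → complexBetti X (2 * j)) (k : ℕ), k < i → (T ^ i) κ k = 0
  | 0, _, k, hk => absurd hk (Nat.not_lt_zero k)
  | i + 1, κ, 0, _ => by rw [pow_succ', Module.End.mul_apply, h0]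
  | i + 1, κ, k + 1, hk => by
    rw [pow_succ', Module.End.mul_apply]
    rcases le_or_gt (k + 1) N with hkN | hkN
    · rw [hs _ k hkN, twistShift_pow_apply_eq_zero_of_lt h0 hs hgt i κ k (by omega), map_zero]
    · exact hgt _ _ hkN

/-- Above the truncation degree every positive power vanishes: `(T^{i+1}κ)_k = 0` for `k > N`. [cite: HatcherAT2002, §3.2] -/
theorem twistShift_pow_succ_apply_eq_zero_of_lt (hgt : ∀ κ j, N < j → T κ j = 0) (i : ℕ)
    (κ : (j : ℕ) → complexBetti X (2 * j)) {k : ℕ} (hk : N < k) : (T ^ (i + 1)) κ k = 0 := by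
  rw [pow_succ', Module.End.mul_apply, hgt _ _ hk]

/-- **Nilpotency**: `T^{N+1} = 0` (a family truncated above degree `N` dies after `N + 1` degree-raising steps). [cite: HatcherAT2002, §3.2] -/
theorem twistShift_pow_succ_eq_zero (h0 : ∀ κ, T κ 0 = 0)
    (hs : ∀ κ j, j + 1 ≤ N → T κ (j + 1) = cupProduct (two_add_two_mul j) B (κ j))
    (hgt : ∀ κ j, N < j → T κ j = 0) : T ^ (N + 1) = 0 := by
  refine LinearMap.ext fun κ => funext fun k => ?_
  rw [LinearMap.zero_apply, Pi.zero_apply]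
  rcases le_or_gt k N with hk | hk
  · exact twistShift_pow_apply_eq_zero_of_lt h0 hs hgt (N + 1) κ k (by omega)
  · exact twistShift_pow_succ_apply_eq_zero_of_lt hgt N κ hk

/-- **The powers of the degree-raising operator are cup products with the cup powers**: `(Tⁱκ)_k = Bⁱ ∪ κ_{k−i}` for
`i ≤ k ≤ N` (induction on `i`: `B ∪ (Bⁱ ∪ κ_{k−1−i}) = (Bⁱ ∪ B) ∪ κ_{k−(i+1)}`, associativity and even-degree commutativity).
[cite: HatcherAT2002, §3.2 and Thm. 3.11] -/
theorem twistShift_pow_apply (h0 : ∀ κ, T κ 0 = 0)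
    (hs : ∀ κ j, j + 1 ≤ N → T κ (j + 1) = cupProduct (two_add_two_mul j) B (κ j))
    (hgt : ∀ κ j, N < j → T κ j = 0) :
    ∀ (i : ℕ) (κ : (j : ℕ) → complexBetti X (2 * j)) (k : ℕ) (hik : i ≤ k), k ≤ N →
      (T ^ i) κ k = cupProduct (two_mul_add_two_mul_sub (Nat.lt_succ_of_le hik)) (cupPowTwo B i) (κ (k - i))
  | 0, κ, k, _, _ => by
    rw [pow_zero, Module.End.one_apply, cupPowTwo_zero]
    exact (one_cupProduct _).symm
  | _ + 1, _, 0, hik, _ => absurd hik (by omega)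
  | i + 1, κ, k + 1, hik, hkN => by
    rw [pow_succ', Module.End.mul_apply, hs _ k hkN, twistShift_pow_apply h0 hs hgt i κ k (by omega) (by omega),
      ← cupProduct_assoc (two_add_two_mul i) (two_mul_add_two_mul_sub (Nat.lt_succ_of_le (by omega : i ≤ k)))
        (by omega : 2 * (i + 1) + 2 * (k - i) = 2 * (k + 1)) (two_add_two_mul k),
      cupProduct_comm_of_deg_two (two_add_two_mul i) (two_mul_add_two i) B (cupPowTwo B i), ← cupPowTwo_succ]
    exact cupProduct_family_congr _ κ (Nat.succ_sub_succ k i).symm _ _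

/-- **Two truncated degree-raising operators commute** (`B ∪ (B' ∪ κ_j) = B' ∪ (B ∪ κ_j)`: associativity and `B ∪ B' = B' ∪ B` in
degree `2`). [cite: HatcherAT2002, §3.2 and Thm. 3.11] -/
theorem twistShift_commute (h0 : ∀ κ, T κ 0 = 0)
    (hs : ∀ κ j, j + 1 ≤ N → T κ (j + 1) = cupProduct (two_add_two_mul j) B (κ j))
    (hgt : ∀ κ j, N < j → T κ j = 0) (h0' : ∀ κ, T' κ 0 = 0)
    (hs' : ∀ κ j, j + 1 ≤ N → T' κ (j + 1) = cupProduct (two_add_two_mul j) B' (κ j))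
    (hgt' : ∀ κ j, N < j → T' κ j = 0) : Commute T T' := by
  show T * T' = T' * T
  refine LinearMap.ext fun κ => funext fun j => ?_
  rw [Module.End.mul_apply, Module.End.mul_apply]
  match j with
  | 0 => rw [h0, h0']
  | j + 1 =>
    rcases le_or_gt (j + 1) N with hj | hj
    · rw [hs _ j hj, hs' _ j hj]
      match j, hj with
      | 0, _ => rw [h0, h0', map_zero, map_zero]
      | j' + 1, hj =>
        rw [hs' _ j' (by omega), hs _ j' (by omega),
          ← cupProduct_assoc (rfl : 2 + 2 = 4) (two_add_two_mul j')
            (by omega : 4 + 2 * j' = 2 * (j' + 1 + 1)) (two_add_two_mul (j' + 1)),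
          ← cupProduct_assoc (rfl : 2 + 2 = 4) (two_add_two_mul j')
            (by omega : 4 + 2 * j' = 2 * (j' + 1 + 1)) (two_add_two_mul (j' + 1)),
          cupProduct_comm_of_deg_two (rfl : 2 + 2 = 4) rfl B B']
    · rw [hgt _ _ hj, hgt' _ _ hj]

/-- **Additivity in the `B`-field**: the sum of the operators for `B` and `B'` is an operator for `B + B'` (the cup product is
bilinear). [cite: HatcherAT2002, §3.2] -/
theorem twistShift_add (h0 : ∀ κ, T κ 0 = 0)
    (hs : ∀ κ j, j + 1 ≤ N → T κ (j + 1) = cupProduct (two_add_two_mul j) B (κ j))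
    (hgt : ∀ κ j, N < j → T κ j = 0) (h0' : ∀ κ, T' κ 0 = 0)
    (hs' : ∀ κ j, j + 1 ≤ N → T' κ (j + 1) = cupProduct (two_add_two_mul j) B' (κ j))
    (hgt' : ∀ κ j, N < j → T' κ j = 0) :
    (∀ κ, (T + T') κ 0 = 0) ∧
      (∀ κ j, j + 1 ≤ N → (T + T') κ (j + 1) = cupProduct (two_add_two_mul j) (B + B') (κ j)) ∧
        ∀ κ j, N < j → (T + T') κ j = 0 := by
  refine ⟨fun κ => ?_, fun κ j hj => ?_, fun κ j hj => ?_⟩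
  · rw [LinearMap.add_apply, Pi.add_apply, h0, h0', add_zero]
  · rw [LinearMap.add_apply, Pi.add_apply, hs _ _ hj, hs' _ _ hj, map_add, LinearMap.add_apply]
  · rw [LinearMap.add_apply, Pi.add_apply, hgt _ _ hj, hgt' _ _ hj, add_zero]

/-- **The truncated exponential of the degree-raising operator computes the `B`-twist**: for `k ≤ N`,
`((Σ_{i ≤ N} (1/i!) Tⁱ) κ)_k = (exp(B) ∪ κ)_k` (the terms `i > k` vanish in degree `k`; the others are `(1/i!) Bⁱ ∪ κ_{k−i}`).
[cite: HuybrechtsStellari2005, §1] [cite: HatcherAT2002, §3.2] -/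
theorem twistShift_expSum_apply (h0 : ∀ κ, T κ 0 = 0)
    (hs : ∀ κ j, j + 1 ≤ N → T κ (j + 1) = cupProduct (two_add_two_mul j) B (κ j))
    (hgt : ∀ κ j, N < j → T κ j = 0) (κ : (j : ℕ) → complexBetti X (2 * j)) {k : ℕ} (hk : k ≤ N) :
    (∑ i ∈ Finset.range (N + 1), ((Nat.factorial i : ℕ) : ℂ)⁻¹ • T ^ i) κ k = expTwistClasses X B κ k := by
  rw [LinearMap.sum_apply, Finset.sum_apply,
    ← Finset.sum_subset (Finset.range_subset_range.2 (by omega : k + 1 ≤ N + 1)) fun i _ hi => ?_]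
  · rw [Finset.sum_range]
    unfold expTwistClasses
    refine Finset.sum_congr rfl fun i _ => ?_
    rw [LinearMap.smul_apply, Pi.smul_apply, twistShift_pow_apply h0 hs hgt i κ k (Nat.le_of_lt_succ i.2) hk]
  · have hki : k < i := by rw [Finset.mem_range] at hi; omega
    rw [LinearMap.smul_apply, Pi.smul_apply, twistShift_pow_apply_eq_zero_of_lt h0 hs hgt i κ k hki, smul_zero]

end Operator

/-! ### §3 Consumer forms of the composition law (the law is `expTwistClasses_add`, p555680) -/

/-- **A twist is determined by any re-gauging**: if `B = B₁ + B₂` then `exp(B) ∪ κ = exp(B₂) ∪ (exp(B₁) ∪ κ)` — the form in which a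
`B`-field is moved to a normalised one `B₁` at the cost of a residual twist by `B₂ = B − B₁` (one line from `expTwistClasses_add` and
`expTwistClasses_comm` of p555680). [cite: HuybrechtsStellari2005, §1] -/
theorem expTwistClasses_eq_of_eq_add {B B₁ B₂ : complexBetti X 2} (hB : B = B₁ + B₂) (κ : (j : ℕ) → complexBetti X (2 * j))
    (k : ℕ) : expTwistClasses X B κ k = expTwistClasses X B₂ (fun j => expTwistClasses X B₁ κ j) k := by
  rw [hB, expTwistClasses_add, expTwistClasses_comm]

/-- **Module form**: the `(B + B')`-twisted Chern character of a module is the `B'`-twist of its `B`-twisted Chern character,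
`(exp(B + B') ∪ ch(E))_k = (exp(B') ∪ (exp(B) ∪ ch(E)))_k`. [cite: HuybrechtsStellari2005, §1 (`ch^{B+B'} = (ch^B)^{B'}`)] -/
theorem expTwistCh_add (C : ChernCharacterBetti) (B B' : complexBetti X 2) (E : X.left.Modules) (k : ℕ) :
    expTwistCh C X (B + B') E k = expTwistClasses X B' (fun j => expTwistCh C X B E j) k :=
  expTwistClasses_eq_of_eq_add rfl _ k

/-! ### §4 Ray stability: twisting by a multiple of `θ` preserves `ℂ[θ]`-valued families up to the top degree -/

/-- **RAY STABILITY**: if `κ_j ∈ ℂ·θʲ` for all `j < k`, then the twist by `μ·θ` moves `κ_k` only along the ray: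
`(exp(μθ) ∪ κ)_k − κ_k ∈ ℂ·θᵏ` (the correction `Σ_{i ≥ 1} (μⁱ/i!) θⁱ ∪ κ_{k−i}` is a multiple of `θᵏ`). In particular a family with ALL
`κ_j ∈ ℂ·θʲ` stays such, and a top class `κ_p = a·w + c·θᵖ` keeps its coefficient `a`. [cite: HuybrechtsStellari2005, §1] [cite: HatcherAT2002, §3.2] -/
theorem expTwistClasses_smul_sub_mem_span_cupPowTwo (θ : complexBetti X 2) (μ : ℂ) {κ : (j : ℕ) → complexBetti X (2 * j)}
    (k : ℕ) (hκ : ∀ j < k, κ j ∈ ℂ ∙ cupPowTwo θ j) :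
    expTwistClasses X (μ • θ) κ k - κ k ∈ ℂ ∙ cupPowTwo θ k :=
  (expTwistClasses_smul_sub_mem_span_of_onRay X μ hκ).2

/-- **Ray stability, equational form below the top**: if `κ_j ∈ ℂ·θʲ` for all `j ≤ k` then `(exp(μθ) ∪ κ)_k ∈ ℂ·θᵏ`.
[cite: HuybrechtsStellari2005, §1] -/
theorem expTwistClasses_smul_mem_span_cupPowTwo (θ : complexBetti X 2) (μ : ℂ) {κ : (j : ℕ) → complexBetti X (2 * j)}
    (k : ℕ) (hκ : ∀ j ≤ k, κ j ∈ ℂ ∙ cupPowTwo θ j) : expTwistClasses X (μ • θ) κ k ∈ ℂ ∙ cupPowTwo θ k := by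
  have h := Submodule.add_mem _ (expTwistClasses_smul_sub_mem_span_cupPowTwo θ μ k fun j hj => hκ j hj.le) (hκ k le_rfl)
  rwa [sub_add_cancel] at h

/-- **Ray stability at the top class**: if `κ_j ∈ ℂ·θʲ` for `j < p` and `κ_p = a·w + c·θᵖ`, then `(exp(μθ) ∪ κ)_p = a·w + c'·θᵖ` for
some `c'` — the leading coefficient `a` of the served class is GAUGE-INVARIANT. [cite: HuybrechtsStellari2005, §1] -/
theorem exists_expTwistClasses_smul_eq_add (θ : complexBetti X 2) (μ : ℂ) {κ : (j : ℕ) → complexBetti X (2 * j)} {p : ℕ}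
    (hκ : ∀ j < p, κ j ∈ ℂ ∙ cupPowTwo θ j) {a c : ℂ} {w : complexBetti X (2 * p)} (hp : κ p = a • w + c • cupPowTwo θ p) :
    ∃ c' : ℂ, expTwistClasses X (μ • θ) κ p = a • w + c' • cupPowTwo θ p := by
  obtain ⟨d, hd⟩ := Submodule.mem_span_singleton.1 (expTwistClasses_smul_sub_mem_span_cupPowTwo θ μ p hκ)
  refine ⟨c + d, ?_⟩
  rw [eq_sub_iff_add_eq] at hd
  rw [← hd, hp, add_smul]
  abel

end Literature.AlgebraicGeometry.HodgeTheory

end
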